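import Summits.CriticalPhenomena.PercolationContinuityZ3.Theorems.PercNearOneGluingNoHeavyLowerTailKnQuestion8CoefficientwisePointLocality
import Summits.CriticalPhenomena.PercolationContinuityZ3.Theorems.PercNearOneGluingNoHeavyLowerTailKnQuestion8CoefficientwisePendant
import HarnessLib

/-!
# z-locality of the point row, II: the pendant step on a sub-multigraph and the classes `|N(z) ∖ {u,w}| ≤ 1` (prim-lf-2 gen 33)

Support file (`--supports stmt-CriticalPhenomena-4575`, closed), prover `prim-lf-2` (gen 33).  No definitions, no named facts, no sorries; standard axioms.
Memo `prim-lf-2/CW-LOCALITY-gen33.md`.  Continues `…CoefficientwisePointLocality` (`pointRow_erase_zEdge`: edges `{z,u}` are invisible to the functional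
`σ_u(s) = 1[u ∈ C_x s] − 1[u ∈ C_x(E∖s)]` paired with anything).
* `Coefficientwise.cwpa_pendant_sub` — the pendant theorem of `…CoefficientwisePendant` (`cwpa_pendant_symm`, prim-lf-2 gen 23) on a SUB-multigraph `E`:
  if `z ≠ x` meets exactly one edge of `E`, then `0 ≤ Σ_{s ⊆ E : wall} Δf·Δg` for all monotone `f, g` (via `offCluster_twoColouring_nonneg_sub`).
* `Coefficientwise.pointRow_nonneg_of_zEdges_pendant` — the `(u,w)` POINT ROW holds whenever the edges at `z` are: any number of edges `{z,u}`, `{z,w}`,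
  and ONE further edge `{z,t}`.
* `Coefficientwise.halfPointRow_nonneg_of_zEdges`, `Coefficientwise.halfPointRow_nonneg_of_zEdges_pendant` — the HALF POINT ROW `0 ≤ Σ_{wall} σ_u·Δg` for
  EVERY monotone `g`, when the edges at `z` are edges `{z,u}` (plus at most one further edge).
[cite: KozmaNitzan2024, Questions 8–9 (§5.5 p. 36) (context: the Question-8 pocket covariance programme)]
-/

namespace Summit.CriticalPhenomena.PercolationContinuityZ3.Theorems

open Finset Literature.Probability.Percolation

namespace Coefficientwise

variable {ι V : Type*} (ends : ι → Sym2 V)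

section pendant

variable [DecidableEq ι]

open Classical in
/-- **Coefficientwise vdBHK-PA for a pendant wall vertex, on a sub-multigraph** (E-relative form of `cwpa_pendant_symm`).  Let `E` be a finite edge set in
which `z ≠ x` meets exactly one edge `e₀`, with ends `{z, v}`.  Then for monotone `f, g : Set V → ℝ`,
`0 ≤ Σ_{s ⊆ E : z ∉ C_x(s), z ∉ C_x(E∖s)} (f(C_x s) − f(C_x(E∖s)))·(g(C_x s) − g(C_x(E∖s)))`.
Proof: resolve the colour of `e₀`; a colouring `t ⊆ E ∖ e₀` survives the wall with `e₀` red iff `v ∉ C_x(t)` and with `e₀` blue iff `v ∉ C_x((E∖e₀)∖t)`,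
the clusters being those of `t`; the two halves agree by the colour swap and each is `offCluster_twoColouring_nonneg_sub` with `A = {v}`.
[cite: KozmaNitzan2024, Questions 8–9 (§5.5 p. 36) (context)] -/
theorem cwpa_pendant_sub (E : Finset ι) {e₀ : ι} (he₀E : e₀ ∈ E) {x z v : V} (he₀ : ends e₀ = s(z, v))
    (hpend : ∀ i ∈ E, z ∈ ends i → i = e₀) (hzx : z ≠ x) (f g : Set V → ℝ) (hf : Monotone f) (hg : Monotone g) :
    0 ≤ ∑ s ∈ E.powerset.filter (fun s : Finset ι => z ∉ openCluster (ends '' (↑s : Set ι)) x ∧ z ∉ openCluster (ends '' (↑(E \ s) : Set ι)) x),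
      (f (openCluster (ends '' (↑s : Set ι)) x) - f (openCluster (ends '' (↑(E \ s) : Set ι)) x)) *
        (g (openCluster (ends '' (↑s : Set ι)) x) - g (openCluster (ends '' (↑(E \ s) : Set ι)) x)) := by
  set K : Finset ι → Set V := fun s => openCluster (ends '' (↑s : Set ι)) x with hK
  set E' : Finset ι := E.erase e₀ with hE'
  set Φ' : Finset ι → ℝ := fun t => (f (K t) - f (K (E' \ t))) * (g (K t) - g (K (E' \ t))) with hΦ'
  change 0 ≤ ∑ s ∈ E.powerset.filter (fun s : Finset ι => z ∉ K s ∧ z ∉ K (E \ s)), (f (K s) - f (K (E \ s))) * (g (K s) - g (K (E \ s)))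
  have heE' : e₀ ∉ E' := Finset.notMem_erase e₀ E
  have hE : E = insert e₀ E' := (Finset.insert_erase he₀E).symm
  -- no edge of `E'` contains `z`
  have hE'z : ∀ i ∈ E', z ∉ ends i := by
    intro i hi hzi
    have hiE : i ∈ E := Finset.mem_of_mem_erase hi
    exact (Finset.ne_of_mem_erase hi) (hpend i hiE hzi)
  have hzK : ∀ t, t ⊆ E' → z ∉ K t := fun t ht => not_mem_openCluster_of_forall_not_mem ends (fun i hi => hE'z i (ht hi)) hzx
  -- the half-sum on `E'`
  have hbase : 0 ≤ ∑ t ∈ E'.powerset.filter (fun t : Finset ι => v ∉ K t), Φ' t := by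
    have := offCluster_twoColouring_nonneg_sub ends E' x ({v} : Set V) f g hf hg
    simpa [hK, hΦ'] using this
  have c1 : ∀ t, t ⊆ E' → (insert e₀ E') \ t = insert e₀ (E' \ t) := by
    intro t ht
    ext i
    simp only [Finset.mem_sdiff, Finset.mem_insert]
    constructor
    · rintro ⟨hi | hi, hni⟩
      · exact Or.inl hi
      · exact Or.inr ⟨hi, hni⟩
    · rintro (rfl | ⟨hi, hni⟩)
      · exact ⟨Or.inl rfl, fun h => heE' (ht h)⟩
      · exact ⟨Or.inr hi, hni⟩
  have c2 : ∀ t, t ⊆ E' → (insert e₀ E') \ (insert e₀ t) = E' \ t := by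
    intro t _
    ext i
    simp only [Finset.mem_sdiff, Finset.mem_insert, not_or]
    constructor
    · rintro ⟨hi | hi, hne, hni⟩
      · exact absurd hi hne
      · exact ⟨hi, hni⟩
    · rintro ⟨hi, hni⟩
      exact ⟨Or.inr hi, fun h => heE' (h ▸ hi), hni⟩
  rw [Finset.sum_filter, hE, Finset.sum_powerset_insert heE']
  -- identify the two halves
  have h1 : ∑ t ∈ E'.powerset, (if z ∉ K t ∧ z ∉ K ((insert e₀ E') \ t) then (f (K t) - f (K ((insert e₀ E') \ t))) * (g (K t) - g (K ((insert e₀ E') \ t))) else 0) =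
      ∑ t ∈ E'.powerset, (if v ∉ K (E' \ t) then Φ' t else 0) := by
    refine Finset.sum_congr rfl fun t ht => ?_
    have hsub : t ⊆ E' := Finset.mem_powerset.mp ht
    rw [c1 t hsub]
    have hzt : z ∉ K t := hzK t hsub
    have hzB : z ∉ K (E' \ t) := hzK (E' \ t) Finset.sdiff_subset
    have hiff : z ∉ K (insert e₀ (E' \ t)) ↔ (z ∉ K (E' \ t) ∧ v ∉ K (E' \ t)) := not_mem_openCluster_insert_zEdge_iff ends he₀
    by_cases hv : v ∈ K (E' \ t)
    · have hz : ¬ (z ∉ K (insert e₀ (E' \ t))) := fun h => (hiff.mp h).2 hv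
      simp [hz, hv]
    · have hKc : K (insert e₀ (E' \ t)) = K (E' \ t) := openCluster_insert_zEdge_eq ends he₀ hzB hv
      have hz : z ∉ K (insert e₀ (E' \ t)) := hiff.mpr ⟨hzB, hv⟩
      simp [hzt, hzB, hv, hKc, hΦ']
  have h2 : ∑ t ∈ E'.powerset, (if z ∉ K (insert e₀ t) ∧ z ∉ K ((insert e₀ E') \ (insert e₀ t)) then
        (f (K (insert e₀ t)) - f (K ((insert e₀ E') \ (insert e₀ t)))) * (g (K (insert e₀ t)) - g (K ((insert e₀ E') \ (insert e₀ t)))) else 0) =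
      ∑ t ∈ E'.powerset, (if v ∉ K t then Φ' t else 0) := by
    refine Finset.sum_congr rfl fun t ht => ?_
    have hsub : t ⊆ E' := Finset.mem_powerset.mp ht
    rw [c2 t hsub]
    have hzt : z ∉ K t := hzK t hsub
    have hzB : z ∉ K (E' \ t) := hzK (E' \ t) Finset.sdiff_subset
    have hiff : z ∉ K (insert e₀ t) ↔ (z ∉ K t ∧ v ∉ K t) := not_mem_openCluster_insert_zEdge_iff ends he₀
    by_cases hv : v ∈ K t
    · have hz : ¬ (z ∉ K (insert e₀ t)) := fun h => (hiff.mp h).2 hv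
      simp [hz, hv]
    · have hKi : K (insert e₀ t) = K t := openCluster_insert_zEdge_eq ends he₀ hzt hv
      have hz : z ∉ K (insert e₀ t) := hiff.mpr ⟨hzt, hv⟩
      simp [hzt, hzB, hv, hKi, hΦ']
  -- the first half equals the second by the colour swap inside `E'`
  have h3 : ∑ t ∈ E'.powerset, (if v ∉ K (E' \ t) then Φ' t else 0) = ∑ t ∈ E'.powerset, (if v ∉ K t then Φ' t else 0) := by
    have hΦsym : ∀ t ∈ E'.powerset, Φ' (E' \ t) = Φ' t := by
      intro t ht
      simp only [hΦ', Finset.sdiff_sdiff_eq_self (Finset.mem_powerset.mp ht)]; ring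
    have := sum_powerset_sdiff E' (fun t => if v ∉ K t then Φ' t else 0)
    rw [← this]
    refine Finset.sum_congr rfl fun t ht => ?_
    simp only [hΦsym t ht]
  rw [h1, h2, h3, ← Finset.sum_filter]
  linarith [hbase]


open Classical in
/-- **The point row when the wall vertex has at most one neighbour besides the two points.**  Let `E` be a finite edge set, `x ≠ z`, and suppose
every edge of `E` at `z` other than `e₀` has ends `{z,u}` or `{z,w}`, where `e₀ ∈ E` has ends `{z,t}` with `t ≠ u`, `t ≠ w`.  Then
`0 ≤ Σ_{s ⊆ E : z ∉ C_x(s), z ∉ C_x(E∖s)} (1[u ∈ C_x s] − 1[u ∈ C_x(E∖s)])·(1[w ∈ C_x s] − 1[w ∈ C_x(E∖s)])`.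
Proof: erase the edges `{z,u}`, `{z,w}` (`pointRow_sdiff_zEdges`, twice: the point row does not see them); `z` becomes pendant and `cwpa_pendant_sub` applies
to the monotone point functionals.  With `pointRow_nonneg_of_zEdges` this settles the point row whenever `|N(z) ∖ {u,w}| ≤ 1` (the extra neighbour joined
by a single edge).  [cite: KozmaNitzan2024, Questions 8–9 (§5.5 p. 36) (context)] -/
theorem pointRow_nonneg_of_zEdges_pendant (E : Finset ι) {x z : V} (hzx : z ≠ x) (u w : V) {e₀ : ι} (he₀E : e₀ ∈ E) {t : V}
    (he₀ : ends e₀ = s(z, t)) (htu : t ≠ u) (htw : t ≠ w) (hzt : z ≠ t)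
    (hN : ∀ i ∈ E, z ∈ ends i → i ≠ e₀ → (ends i = s(z, u) ∨ ends i = s(z, w))) :
    0 ≤ ∑ s ∈ E.powerset.filter (fun s : Finset ι => z ∉ openCluster (ends '' (↑s : Set ι)) x ∧ z ∉ openCluster (ends '' (↑(E \ s) : Set ι)) x),
      ((if u ∈ openCluster (ends '' (↑s : Set ι)) x then (1 : ℝ) else 0) - (if u ∈ openCluster (ends '' (↑(E \ s) : Set ι)) x then (1 : ℝ) else 0)) *
        ((if w ∈ openCluster (ends '' (↑s : Set ι)) x then (1 : ℝ) else 0) - (if w ∈ openCluster (ends '' (↑(E \ s) : Set ι)) x then (1 : ℝ) else 0)) := by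
  set K : Finset ι → Set V := fun s => openCluster (ends '' (↑s : Set ι)) x with hK
  -- `e₀` is neither a `{z,u}` nor a `{z,w}` edge
  have he₀u : ends e₀ ≠ s(z, u) := by
    rw [he₀]; intro h
    rw [Sym2.eq_iff] at h
    rcases h with ⟨_, h⟩ | ⟨_, h2⟩
    · exact htu h
    · exact hzt h2.symm
  have he₀w : ends e₀ ≠ s(z, w) := by
    rw [he₀]; intro h
    rw [Sym2.eq_iff] at h
    rcases h with ⟨_, h⟩ | ⟨_, h2⟩
    · exact htw h
    · exact hzt h2.symm
  -- erase the edges `{z,u}`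
  set Zu : Finset ι := E.filter (fun i => ends i = s(z, u)) with hZu
  have hZuE : Zu ⊆ E := Finset.filter_subset _ _
  have hZue : ∀ i ∈ Zu, ends i = s(z, u) := fun i hi => (Finset.mem_filter.mp hi).2
  rw [pointRow_sdiff_zEdges ends E Zu hZuE hZue (fun S => if w ∈ S then (1 : ℝ) else 0)]
  set E₁ : Finset ι := E \ Zu with hE₁
  set Zw : Finset ι := E₁.filter (fun i => ends i = s(z, w)) with hZw
  have hZwE : Zw ⊆ E₁ := Finset.filter_subset _ _
  have hZwe : ∀ i ∈ Zw, ends i = s(z, w) := fun i hi => (Finset.mem_filter.mp hi).2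
  have hswap : ∀ F : Finset ι, ∑ s ∈ F.powerset.filter (fun s : Finset ι => z ∉ K s ∧ z ∉ K (F \ s)),
      ((if u ∈ K s then (1 : ℝ) else 0) - (if u ∈ K (F \ s) then (1 : ℝ) else 0)) * ((if w ∈ K s then (1 : ℝ) else 0) - (if w ∈ K (F \ s) then (1 : ℝ) else 0)) =
      ∑ s ∈ F.powerset.filter (fun s : Finset ι => z ∉ K s ∧ z ∉ K (F \ s)),
      ((if w ∈ K s then (1 : ℝ) else 0) - (if w ∈ K (F \ s) then (1 : ℝ) else 0)) * ((if u ∈ K s then (1 : ℝ) else 0) - (if u ∈ K (F \ s) then (1 : ℝ) else 0)) :=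
    fun F => Finset.sum_congr rfl fun s _ => mul_comm _ _
  change 0 ≤ ∑ s ∈ E₁.powerset.filter (fun s : Finset ι => z ∉ K s ∧ z ∉ K (E₁ \ s)),
      ((if u ∈ K s then (1 : ℝ) else 0) - (if u ∈ K (E₁ \ s) then (1 : ℝ) else 0)) * ((if w ∈ K s then (1 : ℝ) else 0) - (if w ∈ K (E₁ \ s) then (1 : ℝ) else 0))
  rw [hswap E₁]
  have step2 := pointRow_sdiff_zEdges ends E₁ Zw hZwE (x := x) hZwe (fun S => if u ∈ S then (1 : ℝ) else 0)
  change ∑ s ∈ E₁.powerset.filter (fun s : Finset ι => z ∉ K s ∧ z ∉ K (E₁ \ s)),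
      ((if w ∈ K s then (1 : ℝ) else 0) - (if w ∈ K (E₁ \ s) then (1 : ℝ) else 0)) * ((if u ∈ K s then (1 : ℝ) else 0) - (if u ∈ K (E₁ \ s) then (1 : ℝ) else 0)) =
    ∑ s ∈ (E₁ \ Zw).powerset.filter (fun s : Finset ι => z ∉ K s ∧ z ∉ K ((E₁ \ Zw) \ s)),
      ((if w ∈ K s then (1 : ℝ) else 0) - (if w ∈ K ((E₁ \ Zw) \ s) then (1 : ℝ) else 0)) * ((if u ∈ K s then (1 : ℝ) else 0) - (if u ∈ K ((E₁ \ Zw) \ s) then (1 : ℝ) else 0)) at step2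
  rw [step2]
  set E₂ : Finset ι := E₁ \ Zw with hE₂
  -- in `E₂`, `z` is pendant with edge `e₀`
  have he₀E₂ : e₀ ∈ E₂ := by
    refine Finset.mem_sdiff.mpr ⟨Finset.mem_sdiff.mpr ⟨he₀E, fun h => he₀u (Finset.mem_filter.mp h).2⟩, fun h => he₀w (Finset.mem_filter.mp h).2⟩
  have hpend : ∀ i ∈ E₂, z ∈ ends i → i = e₀ := by
    intro i hi hzi
    by_contra hne
    have hi₁ : i ∈ E₁ := (Finset.mem_sdiff.mp hi).1
    have hiE : i ∈ E := (Finset.mem_sdiff.mp hi₁).1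
    rcases hN i hiE hzi hne with h | h
    · exact (Finset.mem_sdiff.mp hi₁).2 (Finset.mem_filter.mpr ⟨hiE, h⟩)
    · exact (Finset.mem_sdiff.mp hi).2 (Finset.mem_filter.mpr ⟨hi₁, h⟩)
  have hmono : ∀ a : V, Monotone (fun S : Set V => if a ∈ S then (1 : ℝ) else 0) := by
    intro a S T hST
    by_cases ha : a ∈ S
    · have hb : a ∈ T := hST ha
      simp [ha, hb]
    · by_cases hb : a ∈ T
      · simp [ha, hb]
      · simp [ha, hb]
  exact cwpa_pendant_sub ends E₂ he₀E₂ he₀ hpend hzx (fun S => if w ∈ S then (1 : ℝ) else 0) (fun S => if u ∈ S then (1 : ℝ) else 0) (hmono w) (hmono u)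


variable [Fintype ι]

open Classical in
/-- **One point functional against any monotone functional, wall vertex joined only to the point.**  If `x ≠ z` and every edge of `E` at `z` has ends
`{z,u}` (any multiplicity), then for every monotone `g : Set V → ℝ`,
`0 ≤ Σ_{s ⊆ E : z ∉ C_x(s), z ∉ C_x(E∖s)} (1[u ∈ C_x s] − 1[u ∈ C_x(E∖s)])·(g(C_x s) − g(C_x(E∖s)))`:
after erasing the `{z,u}` edges (`pointRow_sdiff_zEdges`) the wall is vacuous and the sum is `harris_twoColouring_powerset`.
[cite: KozmaNitzan2024, Questions 8–9 (§5.5 p. 36) (context)] -/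
theorem halfPointRow_nonneg_of_zEdges (E : Finset ι) {x z : V} (hzx : z ≠ x) (u : V) (hN : ∀ i ∈ E, z ∈ ends i → ends i = s(z, u))
    (g : Set V → ℝ) (hg : Monotone g) :
    0 ≤ ∑ s ∈ E.powerset.filter (fun s : Finset ι => z ∉ openCluster (ends '' (↑s : Set ι)) x ∧ z ∉ openCluster (ends '' (↑(E \ s) : Set ι)) x),
      ((if u ∈ openCluster (ends '' (↑s : Set ι)) x then (1 : ℝ) else 0) - (if u ∈ openCluster (ends '' (↑(E \ s) : Set ι)) x then (1 : ℝ) else 0)) *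
        (g (openCluster (ends '' (↑s : Set ι)) x) - g (openCluster (ends '' (↑(E \ s) : Set ι)) x)) := by
  set K : Finset ι → Set V := fun s => openCluster (ends '' (↑s : Set ι)) x with hK
  set Zu : Finset ι := E.filter (fun i => ends i = s(z, u)) with hZu
  have hZuE : Zu ⊆ E := Finset.filter_subset _ _
  have hZue : ∀ i ∈ Zu, ends i = s(z, u) := fun i hi => (Finset.mem_filter.mp hi).2
  rw [pointRow_sdiff_zEdges ends E Zu hZuE hZue g]
  set E₂ : Finset ι := E \ Zu with hE₂
  have hnoz : ∀ i ∈ E₂, z ∉ ends i := by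
    intro i hi hzi
    have hiE : i ∈ E := (Finset.mem_sdiff.mp hi).1
    exact (Finset.mem_sdiff.mp hi).2 (Finset.mem_filter.mpr ⟨hiE, hN i hiE hzi⟩)
  have hwall : ∀ s ∈ E₂.powerset, z ∉ K s ∧ z ∉ K (E₂ \ s) := by
    intro s hs
    have hsE : s ⊆ E₂ := Finset.mem_powerset.mp hs
    exact ⟨not_mem_openCluster_of_forall_not_mem ends (fun i hi => hnoz i (hsE hi)) hzx,
      not_mem_openCluster_of_forall_not_mem ends (fun i hi => hnoz i (Finset.sdiff_subset hi)) hzx⟩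
  change 0 ≤ ∑ s ∈ E₂.powerset.filter (fun s : Finset ι => z ∉ K s ∧ z ∉ K (E₂ \ s)),
      ((if u ∈ K s then (1 : ℝ) else 0) - (if u ∈ K (E₂ \ s) then (1 : ℝ) else 0)) * (g (K s) - g (K (E₂ \ s)))
  rw [Finset.filter_true_of_mem hwall]
  have hmono : Monotone (fun s : Finset ι => if u ∈ K s then (1 : ℝ) else 0) := by
    intro a b hab
    by_cases ha : u ∈ K a
    · have hb : u ∈ K b := openCluster_image_mono ends hab x ha
      simp [ha, hb]
    · by_cases hb : u ∈ K b
      · simp [ha, hb]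
      · simp [ha, hb]
  have hgmono : Monotone (fun s : Finset ι => g (K s)) := fun a b hab => hg (openCluster_image_mono ends hab x)
  exact harris_twoColouring_powerset E₂ (fun s => if u ∈ K s then (1 : ℝ) else 0) (fun s => g (K s)) hmono hgmono

omit [Fintype ι] in
open Classical in
/-- **One point functional against any monotone functional, wall vertex with one further edge.**  If `x ≠ z`, `e₀ ∈ E` has ends `{z,t}` with `t ≠ u`,
`t ≠ z`, and every other edge of `E` at `z` has ends `{z,u}`, then for every monotone `g : Set V → ℝ`,
`0 ≤ Σ_{s ⊆ E : z ∉ C_x(s), z ∉ C_x(E∖s)} (1[u ∈ C_x s] − 1[u ∈ C_x(E∖s)])·(g(C_x s) − g(C_x(E∖s)))`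
(erase the `{z,u}` edges, then `cwpa_pendant_sub`).  [cite: KozmaNitzan2024, Questions 8–9 (§5.5 p. 36) (context)] -/
theorem halfPointRow_nonneg_of_zEdges_pendant (E : Finset ι) {x z : V} (hzx : z ≠ x) (u : V) {e₀ : ι} (he₀E : e₀ ∈ E) {t : V}
    (he₀ : ends e₀ = s(z, t)) (htu : t ≠ u) (hzt : z ≠ t) (hN : ∀ i ∈ E, z ∈ ends i → i ≠ e₀ → ends i = s(z, u))
    (g : Set V → ℝ) (hg : Monotone g) :
    0 ≤ ∑ s ∈ E.powerset.filter (fun s : Finset ι => z ∉ openCluster (ends '' (↑s : Set ι)) x ∧ z ∉ openCluster (ends '' (↑(E \ s) : Set ι)) x),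
      ((if u ∈ openCluster (ends '' (↑s : Set ι)) x then (1 : ℝ) else 0) - (if u ∈ openCluster (ends '' (↑(E \ s) : Set ι)) x then (1 : ℝ) else 0)) *
        (g (openCluster (ends '' (↑s : Set ι)) x) - g (openCluster (ends '' (↑(E \ s) : Set ι)) x)) := by
  have he₀u : ends e₀ ≠ s(z, u) := by
    rw [he₀]; intro h
    rw [Sym2.eq_iff] at h
    rcases h with ⟨_, h⟩ | ⟨_, h2⟩
    · exact htu h
    · exact hzt h2.symm
  set Zu : Finset ι := E.filter (fun i => ends i = s(z, u)) with hZu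
  have hZuE : Zu ⊆ E := Finset.filter_subset _ _
  have hZue : ∀ i ∈ Zu, ends i = s(z, u) := fun i hi => (Finset.mem_filter.mp hi).2
  rw [pointRow_sdiff_zEdges ends E Zu hZuE hZue g]
  set E₂ : Finset ι := E \ Zu with hE₂
  have he₀E₂ : e₀ ∈ E₂ := Finset.mem_sdiff.mpr ⟨he₀E, fun h => he₀u (Finset.mem_filter.mp h).2⟩
  have hpend : ∀ i ∈ E₂, z ∈ ends i → i = e₀ := by
    intro i hi hzi
    by_contra hne
    have hiE : i ∈ E := (Finset.mem_sdiff.mp hi).1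
    exact (Finset.mem_sdiff.mp hi).2 (Finset.mem_filter.mpr ⟨hiE, hN i hiE hzi hne⟩)
  have hmono : Monotone (fun S : Set V => if u ∈ S then (1 : ℝ) else 0) := by
    intro S T hST
    by_cases ha : u ∈ S
    · have hb : u ∈ T := hST ha
      simp [ha, hb]
    · by_cases hb : u ∈ T
      · simp [ha, hb]
      · simp [ha, hb]
  exact cwpa_pendant_sub ends E₂ he₀E₂ he₀ hpend hzx (fun S => if u ∈ S then (1 : ℝ) else 0) g hmono hg

end pendant

end Coefficientwise

end Summit.CriticalPhenomena.PercolationContinuityZ3.Theorems
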